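import Summits.HubbardSuperconductivity.HubbardSuperconductivity.Theorems.WeakCouplingBCSKlLindhardEnclosureW20OfRules
import Summits.HubbardSuperconductivity.HubbardSuperconductivity.Theorems.WeakCouplingBCSKlLindhardEnclosureFloorRulesOrd

/-!
# KL-MARGIN-SCAN reader (22) «kernel-lindhard-enclosure» — the gate theorems and the `W20` enclosure FROM THE FIVE ORIENTED RULE PREDICATES

The ORIENTED twin of `…W20OfRules` (located item «FLOOR-BDRY-ORIENTATION», T2-2 g22 ✓ p731099: the unoriented boundary-floor predicate
`FloorBdrySoundAt P_W20` is unsatisfiable as typed, so `W20_enclosure_of_five_rules` had no sound conditional reading).  With the floor side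
re-keyed to oriented in-root cells (`…FloorRulesOrd`: `FloorInsideSoundOrd`, `FloorBdrySoundOrd`, `floorSoundAt_of_rulesOrd`) the soundness
debt of the instrument is, BY DECL, exactly FIVE rule-level predicates about ONE guarded, oriented grid cell inside the root square each:
floor side `FloorInsideSoundOrd P` (Jensen floor), `FloorBdrySoundOrd P` (boundary floor); ceiling side `CeilChordSoundOrd P` (chord),
`CeilBdrySoundOrd P` (majorised hyperbola), `CeilTipSoundOrd P` (tip) — `sound_of_five_rulesOrd`, `hull_contains_of_five_rulesOrd`, and the
certificate instance `W20_enclosure_of_five_rulesOrd`: «`0.3287… ≤ χ₀(q_W20; −2399/2500, −3/10) ≤ 0.3462…` MODULO those five ORIENTED rule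
predicates at `P_W20`».  The T2-2 witness (a reversed cell) misses every hypothesis here.  Honest framing: the five oriented rule predicates are
NOT proved in this file; floats are floats; nothing in this file asserts a KL margin at any `t′ ≠ 0`, `K₃`, `U₀`, the window or B1g dominance;
a Kohn–Luttinger instability statement is not ODLRO and nothing here proves superconductivity in the Hubbard model.  (p1 g26, 2026-08-29.)
-/

noncomputable section

set_option linter.dupNamespace false

namespace Summit.HubbardSuperconductivity.HubbardSuperconductivity.Theorems.KlLindhardEnclosure

open Real Set MeasureTheory Literature.MathematicalPhysics.QuantumLattice
open Summit.HubbardSuperconductivity.HubbardSuperconductivity.Theorems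

/-- **BOTH NAMED PREDICATES OF THE GATE, for every tree, from the five ORIENTED rule predicates.** -/
theorem sound_of_five_rulesOrd (P : Params) (hI : FloorInsideSoundOrd P) (hB : FloorBdrySoundOrd P) (hCh : CeilChordSoundOrd P)
    (hBd : CeilBdrySoundOrd P) (hT : CeilTipSoundOrd P) (t : QB) : FloorSoundAt P t ∧ CeilSoundAt P t :=
  ⟨floorSoundAt_of_rulesOrd P hI hB t, ceilSoundAt_of_three_rules P hCh hBd hT t⟩

/-- **THE CONTAINMENT GATE from the five ORIENTED rule predicates**: a hull row `[lo, hi]` confirmed by the kernel at the certificate's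
point holds for the true `χ₀` there. -/
theorem hull_contains_of_five_rulesOrd (P : Params) (hI : FloorInsideSoundOrd P) (hB : FloorBdrySoundOrd P) (hCh : CeilChordSoundOrd P)
    (hBd : CeilBdrySoundOrd P) (hT : CeilTipSoundOrd P) (t : QB) (hP : P.admissible = true) (Nf Nc : ℤ)
    (hE : P.rootEval t = (Nf, some Nc)) (lo hi : ℚ) (hlo : lo * (2 ^ 30 * (2 * KlStair.piUpQ) ^ 2) ≤ Nf)
    (hhi : (Nc : ℚ) ≤ hi * (2 ^ 30 * (2 * FSPoly.piLoQ) ^ 2)) : ((lo : ℚ) : ℝ) ≤ P.chi ∧ P.chi ≤ ((hi : ℚ) : ℝ) :=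
  hull_contains P t (floorSoundAt_of_rulesOrd P hI hB t) (ceilSoundAt_of_three_rules P hCh hBd hT t) hP Nf Nc hE lo hi hlo hhi

/-- **THE `W20` ENCLOSURE from the five ORIENTED rule predicates at `P_W20`**:
`13934968926/(2³⁰(2·piUpQ)²) ≤ χ₀ ≤ 14677221910/(2³⁰(2·piLoQ)²)`. -/
theorem W20_enclosure_of_five_rulesOrd (hI : FloorInsideSoundOrd P_W20) (hB : FloorBdrySoundOrd P_W20) (hCh : CeilChordSoundOrd P_W20)
    (hBd : CeilBdrySoundOrd P_W20) (hT : CeilTipSoundOrd P_W20) :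
    ((13934968926 : ℤ) : ℝ) / (2 ^ 30 * (2 * ((KlStair.piUpQ : ℚ) : ℝ)) ^ 2) ≤ P_W20.chi ∧
    P_W20.chi ≤ ((14677221910 : ℤ) : ℝ) / (2 ^ 30 * (2 * ((FSPoly.piLoQ : ℚ) : ℝ)) ^ 2) :=
  W20_enclosure (floorSoundAt_of_rulesOrd P_W20 hI hB T_W20) (ceilSoundAt_of_three_rules P_W20 hCh hBd hT T_W20)

end Summit.HubbardSuperconductivity.HubbardSuperconductivity.Theorems.KlLindhardEnclosure

end
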